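import Summits.CriticalPhenomena.PercolationContinuityZ3.Theses.PercNonSelfAveraging

/-!
# Route `PercNonSelfAveraging` — the assembly (item `stmt-CriticalPhenomena-7065`)

Settles the route decl
`Summit.CriticalPhenomena.PercolationContinuityZ3.Theses.PercNonSelfAveraging.Assembly`:

  `SelfAveragingUnderJump → ArmMassNSA → PercolationContinuityZ3`.

Pure logic. Write `θ = θ(p_c) = theta (zdGraph 3) 0 (criticalProbI 3)` and `M_n` for the arm mass of
the box `B(n)` (the common inline expression of the route file). Suppose `θ ≠ 0`; since `θ` is a
probability, `θ > 0`. Let `c > 0` be the constant of `ArmMassNSA`, so that FREQUENTLY (for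
infinitely many `n`) `c · (E M_n)² ≤ Var(M_n)` at `p = p_c`. `SelfAveragingUnderJump` at
`p = criticalProbI 3` (where `θ > 0`) with the same `c` gives EVENTUALLY `Var(M_n) < c · (E M_n)²`.
`Filter.Frequently.and_eventually` produces an `n` with both, a contradiction. Hence `θ(p_c) = 0`,
which is `PercolationContinuityZ3` (`percolationContinuityZ3_iff`).
-/

namespace Summit.CriticalPhenomena.PercolationContinuityZ3.Theorems

open MeasureTheory Filter
open Literature.Probability.Percolation Literature.Probability.LatticeModels
open Summit.CriticalPhenomena.PercolationContinuityZ3.Theses.PercNonSelfAveraging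

/-- Settles `stmt-CriticalPhenomena-7065` (exact signature, the route decl `Assembly`):
`SelfAveragingUnderJump → ArmMassNSA → PercolationContinuityZ3` — a jump `θ(p_c) > 0` would make the
critical arm mass self-average (eventually `Var < c E²`), contradicting non-self-averaging
(frequently `c E² ≤ Var`). [folklore] -/
theorem percNonSelfAveraging_assembly_proof :
    Summit.CriticalPhenomena.PercolationContinuityZ3.Theses.PercNonSelfAveraging.Assembly := by
  unfold Summit.CriticalPhenomena.PercolationContinuityZ3.Theses.PercNonSelfAveraging.Assembly
  intro hSA hNSA
  refine Literature.Probability.Percolation.percolationContinuityZ3_iff.mpr ?_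
  by_contra hne
  have h0 : (0 : ℝ) ≤ theta (zdGraph 3) 0 (criticalProbI 3) := by
    unfold Literature.Probability.Percolation.theta
    exact MeasureTheory.measureReal_nonneg
  have hpos : 0 < theta (zdGraph 3) 0 (criticalProbI 3) := lt_of_le_of_ne h0 (Ne.symm hne)
  obtain ⟨c, hc, hfreq⟩ := hNSA
  obtain ⟨n, hle, hlt⟩ := (hfreq.and_eventually (hSA _ hpos c hc)).exists
  exact absurd hlt (not_lt.mpr hle)

end Summit.CriticalPhenomena.PercolationContinuityZ3.Theorems
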